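import Mathlib
import Summits.QuantumFields.YangMills.Theses.MirrorModularBoosts
import Literature.MathematicalPhysics.QuantumLattice.SchwingerOSPositivity

/-!
# Sketch — crux-ideate stmt-QuantumFields-9663 (CurvatureBoostCovariance), ideator 3, round 1

First lemmas of the two idea cards (they must elaborate; they are not proved here).

* `QuarterTurnFormPositive` / `QuarterTurnFormSymmetric` — card `quarter-turn-modular-root`:
  the Euclidean quarter turn of the (x₀,x₁)-plane, pushed through the e₀-OS pairing on
  quadrant-supported functionals, is a positive Hermitian form; its positivity IS reflection
  positivity across the anti-diagonal mirror x₀ + x₁ = 0 (one of the crux's eight frames).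
* `TwoPointDimensionFiveThreshold` — card `sixteen-shell-pincer-dimension-five`: a
  W(B₄)-covariant, translation-invariant two-point distribution that is reflection positive in
  the sixteen root frames and has scaling degree < 10 at the diagonal (field dimension < 5) is
  SO(4)-invariant on ⁰𝒮.
-/

namespace Summit.QuantumFields.YangMills.Cruxes.CurvatureBoostCovariance.Ideator3

open scoped BigOperators
open Literature.MathematicalPhysics.QuantumLattice Literature.MathematicalPhysics.AQFT
open MeasureTheory

/-- Card A, first lemma (positivity half). `R` is the quarter turn `(x₀,x₁) ↦ (x₁,−x₀)` of the
(x₀,x₁)-plane (it maps the quadrant `{x₀>0,x₁>0}` onto `{x₀>0,x₁<0}`), `linActMulti R F = F ∘ R⁻¹`.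
For e₀-time-ordered `F_j` supported in `{x₁ > 0}` the matrix `𝔖(ΘF_i* ⊗ (F_j ∘ R⁻¹))` is
positive: the form is the anti-diagonal OS pairing `𝔖(θ_{ad} F̄ ⊗ F)`, θ_{ad} = reflection across
`x₀ + x₁ = 0`, and the quadrant lies on its `+` side. Inputs: E3, quarter-turn invariance on ⁰𝒮,
RP in the frame with time axis `(e₀+e₁)/√2`. -/
def QuarterTurnFormPositive : Prop :=
  let E := EuclideanSpace ℝ (Fin 4)
  ∀ (S : SchwingerFamily E), S.toLabelled.IsSymmetric →
    ∀ (R : E ≃ₗᵢ[ℝ] E),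
      R (EuclideanSpace.single 0 1) = -EuclideanSpace.single 1 1 →
      R (EuclideanSpace.single 1 1) = EuclideanSpace.single 0 1 →
      R (EuclideanSpace.single 2 1) = EuclideanSpace.single 2 1 →
      R (EuclideanSpace.single 3 1) = EuclideanSpace.single 3 1 →
      (∀ (n : ℕ) (F : SchwartzMap (Fin n → E) ℂ), IsOffDiagonal F → S n (linActMulti R F) = S n F) →
      (∀ (R' : E ≃ₗᵢ[ℝ] E) (a : ℝ), a ^ 2 = 1 / 2 → 0 < a →
          R' (EuclideanSpace.single 0 1) = a • EuclideanSpace.single 0 1 + a • EuclideanSpace.single 1 1 →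
          (SchwingerFamily.toLabelled (fun n => (S n).comp (linActMulti R'))).IsReflectionPositive) →
      ∀ (N : ℕ) (deg : Fin N → ℕ) (F : (j : Fin N) → SchwartzMap (Fin (deg j) → E) ℂ),
        (∀ j, IsTimeOrdered (F j)) →
        (∀ j, tsupport (F j : (Fin (deg j) → E) → ℂ) ⊆ {x | ∀ i, 0 < x i 1}) →
        let z := ∑ i, ∑ j, SchwingerFamily.osPairing S (F i) (linActMulti R (F j))
        0 ≤ z.re ∧ z.im = 0

/-- Card A, first lemma (symmetry half): with E0 hermiticity and quarter-turn invariance the same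
form is Hermitian, `𝔖(ΘG* ⊗ F∘R⁻¹) = conj 𝔖(ΘF* ⊗ G∘R⁻¹)` — because conjugating the quarter
turn by the time reflection inverts it (`θ₀ R θ₀ = R⁻¹`). Positivity + symmetry make the
densely defined quarter-turn operator `V[F] := [F ∘ R⁻¹]` on the e₀-OS space positive and
symmetric; the card's conjecture is `closure V = Δ_{W_R}^{1/4}`. -/
def QuarterTurnFormSymmetric : Prop :=
  let E := EuclideanSpace ℝ (Fin 4)
  ∀ (S : SchwingerFamily E), S.toLabelled.IsSymmetric → S.toLabelled.IsHermitian →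
    ∀ (R : E ≃ₗᵢ[ℝ] E),
      R (EuclideanSpace.single 0 1) = -EuclideanSpace.single 1 1 →
      R (EuclideanSpace.single 1 1) = EuclideanSpace.single 0 1 →
      R (EuclideanSpace.single 2 1) = EuclideanSpace.single 2 1 →
      R (EuclideanSpace.single 3 1) = EuclideanSpace.single 3 1 →
      (∀ (n : ℕ) (F : SchwartzMap (Fin n → E) ℂ), IsOffDiagonal F → S n (linActMulti R F) = S n F) →
      ∀ (n m : ℕ) (F : SchwartzMap (Fin n → E) ℂ) (G : SchwartzMap (Fin m → E) ℂ),
        IsTimeOrdered F → IsTimeOrdered G →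
        tsupport (F : (Fin n → E) → ℂ) ⊆ {x | ∀ i, 0 < x i 1} →
        tsupport (G : (Fin m → E) → ℂ) ⊆ {x | ∀ i, 0 < x i 1} →
        SchwingerFamily.osPairing S G (linActMulti R F) = (starRingEnd ℂ) (SchwingerFamily.osPairing S F (linActMulti R G))

/-- Card B, first lemma: the dimension-five threshold (repair of the falsified massive
B₄-rigidity R₄ of card sixteen-mirrors-o4-rigidity: all three recorded Gaussian killers have
scaling degree exactly 10). Hypotheses: E3; translation invariance and proper-signed-permutation
invariance on ⁰𝒮 (as in the crux's W₁); reflection positivity in pull-back form for every frame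
whose time axis is a root direction `a e_μ + b e_ν` (`a²+b²=1`, `a=0 ∨ b=0 ∨ a²=b²`, μ ≠ ν: the
sixteen W(B₄) mirrors); and a kernel `K` representing `𝔖₂` on ⁰𝒮 with `|K(v)| ≤ C(|v|^{ε-10}+1)`
(scaling degree < 10, i.e. field dimension < 5). Conclusion: `𝔖₂` is SO(4)-invariant on ⁰𝒮. -/
def TwoPointDimensionFiveThreshold : Prop :=
  let E := EuclideanSpace ℝ (Fin 4)
  ∀ (S : SchwingerFamily E), S.toLabelled.IsSymmetric →
    (∀ (n : ℕ) (a : E) (F : SchwartzMap (Fin n → E) ℂ), IsOffDiagonal F → S n (translateMulti a F) = S n F) →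
    (∀ (R : E ≃ₗᵢ[ℝ] E), LinearMap.det (R.toLinearEquiv : E →ₗ[ℝ] E) = 1 →
      (∀ i : Fin 4, ∃ j : Fin 4, R (EuclideanSpace.single i 1) = EuclideanSpace.single j 1 ∨
        R (EuclideanSpace.single i 1) = -EuclideanSpace.single j 1) →
      ∀ (n : ℕ) (F : SchwartzMap (Fin n → E) ℂ), IsOffDiagonal F → S n (linActMulti R F) = S n F) →
    (∀ (R : E ≃ₗᵢ[ℝ] E) (μ ν : Fin 4) (a b : ℝ), μ ≠ ν → a ^ 2 + b ^ 2 = 1 →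
      (a = 0 ∨ b = 0 ∨ a ^ 2 = b ^ 2) →
      R (EuclideanSpace.single 0 1) = a • EuclideanSpace.single μ 1 + b • EuclideanSpace.single ν 1 →
      (SchwingerFamily.toLabelled (fun n => (S n).comp (linActMulti R))).IsReflectionPositive) →
    (∃ (K : E → ℂ) (C ε : ℝ), Measurable K ∧ 0 < ε ∧
      (∀ v : E, v ≠ 0 → ‖K v‖ ≤ C * (‖v‖ ^ (ε - 10) + 1)) ∧
      ∀ F : SchwartzMap (Fin 2 → E) ℂ, IsOffDiagonal F →
        S 2 F = ∫ x : Fin 2 → E, K (x 0 - x 1) * F x) →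
    ∀ (R : E ≃ₗᵢ[ℝ] E), LinearMap.det (R.toLinearEquiv : E →ₗ[ℝ] E) = 1 →
      ∀ F : SchwartzMap (Fin 2 → E) ℂ, IsOffDiagonal F → S 2 (linActMulti R F) = S 2 F

/-- The planar corollary in the crux's own shape: under the hypotheses of
`CurvatureBoostCovariance` plus the dimension bound on the curvature two-point kernel, the
two-point function `S₁ 2` is invariant under the rotations of the (x₀,x₁)-plane. (Typed to make
sure the threshold lemma plugs into the crux: W₁'s proper-hypercubic clause and the eight planar
frames, transported by W(B₄), give the sixteen root frames.) -/
def CurvatureTwoPointPlanarIsotropy : Prop :=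
  let E := EuclideanSpace ℝ (Fin 4)
  ∀ (S₁ : SchwingerFamily E), S₁.toLabelled.IsSymmetric →
    (∀ (n : ℕ) (a : E) (F : SchwartzMap (Fin n → E) ℂ), IsOffDiagonal F → S₁ n (translateMulti a F) = S₁ n F) →
    (∀ (R : E ≃ₗᵢ[ℝ] E), LinearMap.det (R.toLinearEquiv : E →ₗ[ℝ] E) = 1 →
      (∀ i : Fin 4, ∃ j : Fin 4, R (EuclideanSpace.single i 1) = EuclideanSpace.single j 1 ∨
        R (EuclideanSpace.single i 1) = -EuclideanSpace.single j 1) →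
      ∀ (n : ℕ) (F : SchwartzMap (Fin n → E) ℂ), IsOffDiagonal F → S₁ n (linActMulti R F) = S₁ n F) →
    (∀ (R : E ≃ₗᵢ[ℝ] E) (a b : ℝ), a ^ 2 + b ^ 2 = 1 → (a = 0 ∨ b = 0 ∨ a ^ 2 = b ^ 2) →
      R (EuclideanSpace.single 0 1) = a • EuclideanSpace.single 0 1 + b • EuclideanSpace.single 1 1 →
      (SchwingerFamily.toLabelled (fun n => (S₁ n).comp (linActMulti R))).IsReflectionPositive) →
    (∃ (K : E → ℂ) (C ε : ℝ), Measurable K ∧ 0 < ε ∧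
      (∀ v : E, v ≠ 0 → ‖K v‖ ≤ C * (‖v‖ ^ (ε - 10) + 1)) ∧
      ∀ F : SchwartzMap (Fin 2 → E) ℂ, IsOffDiagonal F →
        S₁ 2 F = ∫ x : Fin 2 → E, K (x 0 - x 1) * F x) →
    ∀ (R : E ≃ₗᵢ[ℝ] E), LinearMap.det (R.toLinearEquiv : E →ₗ[ℝ] E) = 1 →
      R (EuclideanSpace.single 2 1) = EuclideanSpace.single 2 1 →
      R (EuclideanSpace.single 3 1) = EuclideanSpace.single 3 1 →
      ∀ F : SchwartzMap (Fin 2 → E) ℂ, IsOffDiagonal F → S₁ 2 (linActMulti R F) = S₁ 2 F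

/-- Bookkeeping check (provable now, pure group theory as in the route's MirrorTransport):
the sixteen-frame hypothesis of `TwoPointDimensionFiveThreshold` follows from the eight planar
frames plus proper-signed-permutation invariance; hence the threshold lemma implies the planar
corollary. Stated, not proved. -/
def ThresholdImpliesPlanar : Prop :=
  TwoPointDimensionFiveThreshold → CurvatureTwoPointPlanarIsotropy

end Summit.QuantumFields.YangMills.Cruxes.CurvatureBoostCovariance.Ideator3
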